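import Mathlib.CategoryTheory.SingleObj
import Mathlib.Data.ZMod.Basic
import Literature.AnabelianGeometry.EtaleTheta.TemperedFrobenioidCnst
import Literature.AnabelianGeometry.EtaleTheta.TemperedFrobenioidToy
import HarnessLib

/-!
# [EtTh] Thm 3.7 (iii) at `Λ = ℚ`: torsion-faithfulness `hQ` is NOT a consequence of the typed `B₀`-level
# Prop 3.4 (ii) clause `Prop34Cnst₀` — kernel certificate (cell row R123 (b), GAP G-w4d084-2)

S. Mochizuki, *The étale theta function …*, Publ. RIMS **45** (2009) [MochizukiEtTh2009], Thm 3.7 (iii) PDF pp.79–80: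
the action of `Aut` on `O^×`/`O^▷` "factors through `Aut_{D^cnst}` … this factorization determines a faithful action … if
`Λ ∈ {ℤ, ℚ}`" [cite: MochizukiEtTh2009, Thm 3.7 (iii) p.79]; Prop 3.4 (ii) p.74 (`O_L^× = Ker(B₀ → Φ₀^gp)`).

abc-iut cell, layer L2, seat abc-iut-L2-t3 (gen 4; owner of `DivisorMonoids.Prop34Cnst₀`, TemperedFrobenioidCnst.lean), row
R123 (b) of abc-iut-L2-lead (2026-08-26T06:28Z): "decide hQ (prove it, or land a kernel countermodel à la p424811) for the
`Prop34Cnst₀`-bearing constructions".  abc-iut-w4-d084's reductions (Discharge/Sec3Prop34CnstOfRlfQ.lean, p427133) are exact: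
`torsionFaithful_of_prop34Cnst_ofRlfQ` (clause 4 of `Prop34Cnst (ofRlfQ dm hpf) cnst` ⇒ hQ) and
`torsionFaithful_of_prop34Cnst₀_of_torsionFree` (hQ ⇐ `Prop34Cnst₀` PROVIDED `Ker(div₀)` has no torsion).  This file shows the
torsion-freeness proviso cannot be dropped: over the one-object base `B = SingleObj ℤ` (automorphism group `ℤ`, generator `γ`) take
`Φ₀ := ℕ` (trivial action), `B₀ := ℤ × (ℤ/2)²` with `γ` acting by SWAPPING the two `ℤ/2`-factors, `div₀ :=` first projection
(so `Ker(div₀) = (ℤ/2)²` IS TORSION), `F₀ := B₀`, and the constant-field functor `cnst : SingleObj ℤ → SingleObj (ℤ/2)`,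
`n ↦ n mod 2` — faithful EXACTLY on the action on `Ker(div₀)` (`γ^m`, `γ^n` act alike iff `m ≡ n (2)`).  Then:
* `ToyTorsion.prop34Cnst₀` — every clause of abc-iut-L2-t3's `DivisorMonoids.Prop34Cnst₀ dm cnst` HOLDS;
* `ToyTorsion.hQ_premise` — the premise of hQ holds for EVERY pair of automorphisms (all of `Ker(div₀)` is `2`-torsion);
* `ToyTorsion.not_hQ` — hQ FAILS (`cnst γ ≠ cnst 1`); hence `ToyTorsion.hQ_not_derivable`: the universal closure
  «`Prop34Cnst₀` ⇒ hQ» over Def 3.3 (iii) data is REFUTED — torsion in `O_L^× = Ker(div₀)` (the roots of unity of `L`, present in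
  print) is precisely the obstruction, so the `Λ = ℚ` faithfulness clause of Thm 3.7 (iii) is a GENUINE additional input of the
  interface (census item A3 of the 13:00Z L2 v-next draft), as G-w4d084-2 records.
HONEST FRAMING: a statement about the cell's typed interface, not about the tempered Frobenioids of a curve (for which `Aut(L/K)`
acts faithfully on `(O_L^×)^pf` by Thm 3.7 (iii)); refereed pre-IUT material; nothing here bears on [IUTchIII] Cor. 3.12.
-/

noncomputable section

namespace Literature.AnabelianGeometry.EtaleTheta

open CategoryTheory Opposite Literature.AlgebraicGeometry.Frobenioids

namespace ToyTorsion

/-- The base `D₀ := SingleObj ℤ`: one object, automorphism group `ℤ`. [cite: MochizukiEtTh2009, Def 3.3 p.73] -/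
abbrev Base : Type := SingleObj (Multiplicative ℤ)

/-- The constant-field category `D^cnst := SingleObj (ℤ/2)`. [cite: MochizukiEtTh2009, Def 3.3 p.73] -/
abbrev Cnst : Type := SingleObj (Multiplicative (ZMod 2))

/-- `(ℤ/2)²`, written multiplicatively: the torsion of `Ker(div₀)`. [cite: MochizukiEtTh2009, Prop 3.4 (ii) p.74] -/
abbrev V : Type := Multiplicative (ZMod 2) × Multiplicative (ZMod 2)

/-- `B₀ := ℤ × (ℤ/2)²` (log-meromorphic functions, multiplicatively). [cite: MochizukiEtTh2009, Def 3.3 p.73] -/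
abbrev M : Type := Multiplicative ℤ × V

/-- The swap of the two `ℤ/2`-factors, as a monoid automorphism of `B₀`. [cite: MochizukiEtTh2009, Def 3.3 p.73] -/
def swapE : MulAut M := MulEquiv.prodCongr (MulEquiv.refl (Multiplicative ℤ)) MulEquiv.prodComm

/-- `swapE` on elements. [cite: MochizukiEtTh2009, Def 3.3 p.73] -/
@[simp] theorem swapE_apply (x : M) : swapE x = (x.1, (x.2.2, x.2.1)) := rfl

/-- `swapE` is an involution. [cite: MochizukiEtTh2009, Def 3.3 p.73] -/
theorem swapE_sq : swapE ^ (2 : ℤ) = 1 := by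
  rw [zpow_two]
  exact MulEquiv.ext fun x => rfl

/-- `swapE ^ k` depends only on `k mod 2`. [cite: MochizukiEtTh2009, Def 3.3 p.73] -/
theorem swapE_zpow_eq_mod (k : ℤ) : swapE ^ k = swapE ^ (k % 2) := by
  conv_lhs => rw [← Int.emod_add_mul_ediv k 2, zpow_add, zpow_mul, swapE_sq, one_zpow, mul_one]

/-- The action of `Aut(⋆) = ℤ` on `B₀`: `n ↦ swapE ^ n`. [cite: MochizukiEtTh2009, Def 3.3 p.73] -/
def act : Multiplicative ℤ →* MulAut M := zpowersHom (MulAut M) swapE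

/-- `act n = swapE ^ n`. [cite: MochizukiEtTh2009, Def 3.3 p.73] -/
theorem act_apply (n : Multiplicative ℤ) : act n = swapE ^ n.toAdd := rfl

/-- The action preserves the first (`ℤ`-)coordinate. [cite: MochizukiEtTh2009, Def 3.3 p.73] -/
theorem act_fst (n : Multiplicative ℤ) (x : M) : (act n x).1 = x.1 := by
  rw [act_apply, swapE_zpow_eq_mod]
  rcases Int.emod_two_eq_zero_or_one n.toAdd with h | h <;> rw [h]
  · rw [zpow_zero, MulAut.one_apply]
  · rw [zpow_one, swapE_apply]

/-- Automorphisms congruent mod `2` act alike on `B₀`. [cite: MochizukiEtTh2009, Def 3.3 p.73] -/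
theorem act_eq_of_emod_eq {m n : Multiplicative ℤ} (h : m.toAdd % 2 = n.toAdd % 2) : act m = act n := by
  rw [act_apply, act_apply, swapE_zpow_eq_mod, h, ← swapE_zpow_eq_mod]

/-- The test element `b₀ := (0, (1, 0)) ∈ Ker(div₀)` (multiplicatively `(1, (γ̄, 1))`). [cite: MochizukiEtTh2009, Prop 3.4 (ii) p.74] -/
def b₀ : M := (1, (Multiplicative.ofAdd 1, 1))

/-- `swapE` MOVES `b₀`. [cite: MochizukiEtTh2009, Prop 3.4 (ii) p.74] -/
theorem swapE_b₀_ne : swapE b₀ ≠ b₀ := by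
  intro h
  have h2 : (swapE b₀).2.2 = b₀.2.2 := by rw [h]
  change Multiplicative.ofAdd (1 : ZMod 2) = Multiplicative.ofAdd 0 at h2
  exact absurd (Multiplicative.ofAdd.injective h2) (by decide)

/-- Automorphisms acting alike on `b₀` are congruent mod `2`. [cite: MochizukiEtTh2009, Prop 3.4 (ii) p.74] -/
theorem emod_eq_of_act_b₀_eq {m n : Multiplicative ℤ} (h : act m b₀ = act n b₀) : m.toAdd % 2 = n.toAdd % 2 := by
  rw [act_apply, act_apply, swapE_zpow_eq_mod m.toAdd, swapE_zpow_eq_mod n.toAdd] at h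
  rcases Int.emod_two_eq_zero_or_one m.toAdd with hm | hm <;>
    rcases Int.emod_two_eq_zero_or_one n.toAdd with hn | hn <;> rw [hm, hn] at h ⊢
  · exfalso; rw [zpow_zero, zpow_one, MulAut.one_apply] at h; exact swapE_b₀_ne h.symm
  · exfalso; rw [zpow_zero, zpow_one, MulAut.one_apply] at h; exact swapE_b₀_ne h

/-- `(u v : M) ↦` the composition law of the action: `act (u·v) = act v ∘ act u` (the action is abelian).
[cite: MochizukiEtTh2009, Def 3.3 p.73] -/
theorem act_comp (u v : Multiplicative ℤ) :
    (act (u * v)).toMonoidHom = (act v).toMonoidHom.comp (act u).toMonoidHom := by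
  rw [mul_comm, map_mul]
  rfl

/-- `B₀` as a monoid on `SingleObj ℤ`: `n` acts by `swapE ^ n`. [cite: MochizukiEtTh2009, Def 3.3 p.73] -/
def B₀ : Baseᵒᵖ ⥤ CommMonCat.{0} where
  obj _ := CommMonCat.of M
  map f := CommMonCat.ofHom (act f.unop).toMonoidHom
  map_id X := by
    apply CommMonCat.hom_ext
    change (act 1).toMonoidHom = MonoidHom.id M
    rw [map_one]
    rfl
  map_comp f g := by
    apply CommMonCat.hom_ext
    exact act_comp f.unop g.unop

/-- **The Def 3.3 (iii) data of the counter-model**: `Φ₀ = ℕ` (trivial action), `B₀ = ℤ × (ℤ/2)²` (swap action),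
`div₀ =` first projection (via `Toy.divHom`), `F₀ = B₀`, nothing cuspidal. [cite: MochizukiEtTh2009, Def 3.3 p.73] -/
def divisorMonoids : DivisorMonoids.{0, 0, 0} Base where
  Φ₀ := (Functor.const _).obj (CommMonCat.of (Multiplicative ℕ))
  B₀ := B₀
  isUnit_B₀ _ b := by
    change IsUnit (M := M) b
    exact Group.isUnit _
  div₀ _ := Toy.divHom.comp (MonoidHom.fst (Multiplicative ℤ) V)
  div₀_natural f b := by
    change Toy.divHom (act f.unop b).1 = gpMap (MonoidHom.id _) (Toy.divHom b.1)
    rw [act_fst]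
    exact (DFunLike.congr_fun (Literature.AlgebraicGeometry.Frobenioids.gpMap_id (M := Multiplicative ℕ))
      (Toy.divHom b.1)).symm
  F₀ _ := ⊤
  F₀_map _ _ _ := trivial
  ncsp₀ _ := ⊤
  csp₀ _ := ⊥
  ncsp₀_map _ _ _ := trivial
  csp₀_map _ x hx := by
    rw [Submonoid.mem_bot] at hx ⊢
    rw [hx, map_one]
  existsUnique_ncsp_csp _ x := by
    refine ⟨(⟨x, trivial⟩, ⟨1, Submonoid.mem_bot.mpr rfl⟩), mul_one x, ?_⟩
    rintro ⟨a, c⟩ h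
    have hc : c.1 = 1 := Submonoid.mem_bot.mp c.2
    have ha : a.1 = x := by
      have h' : a.1 * c.1 = x := h
      rwa [hc, mul_one] at h'
    exact Prod.ext (Subtype.ext ha) (Subtype.ext hc)

/-- `ℤ → ℤ/2`, multiplicatively. [cite: MochizukiEtTh2009, Def 3.3 p.73] -/
def castHom : Multiplicative ℤ →* Multiplicative (ZMod 2) := (Int.castAddHom (ZMod 2)).toMultiplicative

/-- `castHom` is reduction mod `2`. [cite: MochizukiEtTh2009, Def 3.3 p.73] -/
theorem castHom_eq_iff (m n : Multiplicative ℤ) : castHom m = castHom n ↔ m.toAdd % 2 = n.toAdd % 2 := by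
  change Multiplicative.ofAdd ((m.toAdd : ℤ) : ZMod 2) = Multiplicative.ofAdd ((n.toAdd : ℤ) : ZMod 2) ↔ _
  rw [Multiplicative.ofAdd.injective.eq_iff]
  exact ZMod.intCast_eq_intCast_iff' _ _ 2

/-- **The constant-field functor `D₀ → D^cnst`**: `SingleObj ℤ → SingleObj (ℤ/2)`, `n ↦ n mod 2`.
[cite: MochizukiEtTh2009, Def 3.3 p.73] -/
def cnst : Base ⥤ Cnst := SingleObj.mapHom _ _ castHom

/-- `cnst` on morphisms is reduction mod `2`. [cite: MochizukiEtTh2009, Def 3.3 p.73] -/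
theorem cnst_map {Y Y' : Base} (g : Y ⟶ Y') : cnst.map g = castHom g := rfl

/-- **Every clause of the typed `B₀`-level Prop 3.4 (ii) structure `Prop34Cnst₀` HOLDS at the counter-model**
(the pull-back action on `F₀ = B₀` and on `Φ₀` factors through `cnst`, and automorphisms acting identically on
`Ker(div₀)` have the same image under `cnst`). [cite: MochizukiEtTh2009, Prop 3.4 (ii) p.74] -/
theorem prop34Cnst₀ : divisorMonoids.Prop34Cnst₀ cnst where
  B₀_map_eq_of_cnst_map_eq g g' h b _ := by
    rw [cnst_map, cnst_map, castHom_eq_iff] at h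
    change act g b = act g' b
    rw [act_eq_of_emod_eq h]
  Φ₀_map_eq_of_cnst_map_eq _ _ _ _ _ := rfl
  cnst_map_eq_of_B₀_map_eq g g' hker := by
    rw [cnst_map, cnst_map, castHom_eq_iff]
    exact emod_eq_of_act_b₀_eq (hker b₀ (by change Toy.divHom 1 = 1; exact map_one _))

/-- The generator `γ = 1 ∈ ℤ` of `Aut(⋆)`, as an isomorphism of the base. [cite: MochizukiEtTh2009, Def 3.3 p.73] -/
def γ : (SingleObj.star (Multiplicative ℤ) : Base) ≅ SingleObj.star (Multiplicative ℤ) where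
  hom := Multiplicative.ofAdd 1
  inv := Multiplicative.ofAdd (-1)
  hom_inv_id := rfl
  inv_hom_id := rfl

/-- Every element of `(ℤ/2)` written multiplicatively squares to `1`. [folklore] -/
private theorem sq_eq_one_V (v : Multiplicative (ZMod 2)) : v ^ (2 : ℕ) = 1 := by
  apply Multiplicative.toAdd.injective
  rw [toAdd_pow, toAdd_one, two_nsmul]
  exact (by decide : ∀ x : ZMod 2, x + x = 0) _

/-- **The premise of hQ holds for EVERY pair of automorphisms** of the counter-model: all of `Ker(div₀) = (ℤ/2)²`
— indeed all of the `(ℤ/2)²`-part of `B₀` — is `2`-torsion and the action fixes the `ℤ`-coordinate.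
[cite: MochizukiEtTh2009, Thm 3.7 (iii) p.79] -/
theorem hQ_premise {Y : Base} (g g' : Y ≅ Y) (b : divisorMonoids.B₀.obj (op Y)) :
    ∃ N : ℕ+, ((divisorMonoids.B₀.map g.hom.op).hom b) ^ (N : ℕ) = ((divisorMonoids.B₀.map g'.hom.op).hom b) ^ (N : ℕ) := by
  refine ⟨2, ?_⟩
  change (act g.hom b) ^ (2 : ℕ) = (act g'.hom b) ^ (2 : ℕ)
  apply Prod.ext
  · rw [Prod.pow_fst, Prod.pow_fst, act_fst, act_fst]
  · apply Prod.ext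
    · rw [Prod.pow_snd, Prod.pow_snd, Prod.pow_fst, Prod.pow_fst, sq_eq_one_V, sq_eq_one_V]
    · rw [Prod.pow_snd, Prod.pow_snd, Prod.pow_snd, Prod.pow_snd, sq_eq_one_V, sq_eq_one_V]

/-- **hQ FAILS at the counter-model**: the premise holds for `(γ, 1)` but `cnst γ = 1 mod 2 ≠ 0 mod 2 = cnst 1`.
[cite: MochizukiEtTh2009, Thm 3.7 (iii) p.79] -/
theorem not_hQ : ¬ (∀ {Y : Base} (g g' : Y ≅ Y), (∀ b : divisorMonoids.B₀.obj (op Y),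
      divisorMonoids.div₀ (op Y) b = 1 →
        ∃ N : ℕ+, ((divisorMonoids.B₀.map g.hom.op).hom b) ^ (N : ℕ) =
          ((divisorMonoids.B₀.map g'.hom.op).hom b) ^ (N : ℕ)) → cnst.map g.hom = cnst.map g'.hom) := by
  intro h
  have e := h γ (Iso.refl _) (fun b _ => hQ_premise γ (Iso.refl _) b)
  rw [cnst_map, cnst_map, castHom_eq_iff] at e
  change (1 : ℤ) % 2 = (0 : ℤ) % 2 at e
  exact absurd e (by decide)

/-- **KERNEL CERTIFICATE (row R123 (b), GAP G-w4d084-2)**: there are Def 3.3 (iii) data and a constant-field functor for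
which abc-iut-L2-t3's typed `Prop34Cnst₀` holds and the `Λ = ℚ` torsion-faithfulness hQ of Thm 3.7 (iii) fails — hQ is NOT
derivable from `Prop34Cnst₀`; the torsion of `Ker(div₀)` (print: the roots of unity `μ(L) ⊆ O_L^×`) is exactly the obstruction
(cf. `torsionFaithful_of_prop34Cnst₀_of_torsionFree`). [cite: MochizukiEtTh2009, Thm 3.7 (iii) p.79] -/
theorem hQ_not_derivable :
    ∃ (D₀ : Type) (_ : Category.{0} D₀) (dm : DivisorMonoids.{0, 0, 0} D₀) (Dc : Type) (_ : Category.{0} Dc)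
      (c : D₀ ⥤ Dc), dm.Prop34Cnst₀ c ∧
      ¬ (∀ {Y : D₀} (g g' : Y ≅ Y), (∀ b : dm.B₀.obj (op Y), dm.div₀ (op Y) b = 1 →
        ∃ N : ℕ+, ((dm.B₀.map g.hom.op).hom b) ^ (N : ℕ) = ((dm.B₀.map g'.hom.op).hom b) ^ (N : ℕ)) →
          c.map g.hom = c.map g'.hom) :=
  ⟨Base, inferInstance, divisorMonoids, Cnst, inferInstance, cnst, prop34Cnst₀, not_hQ⟩

end ToyTorsion

end Literature.AnabelianGeometry.EtaleTheta

end
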